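import Literature.MathematicalPhysics.QuantumFieldTheory.Balaban1983to89.B9RWSumsAllBlocksPairM
import Literature.MathematicalPhysics.QuantumFieldTheory.Balaban1983to89.B9RWSums343HolderDir
import Literature.MathematicalPhysics.QuantumFieldTheory.Balaban1983to89.B9RWSums346SecondDiffDir
import Literature.MathematicalPhysics.QuantumFieldTheory.Balaban1983to89.B9RWSums346SecondDiffLeftPairMG
import Literature.MathematicalPhysics.QuantumFieldTheory.Balaban1983to89.B9RWSums346MixedPairGDir
import Literature.MathematicalPhysics.QuantumFieldTheory.Balaban1983to89.B9RWSums344InputPairGDir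

/-!
# `Balaban1983to89.B9RWSumsAllBlocksPairMGDir3` — THEOREM 3.10 AT THE ALL-BLOCKS PIN OVER THE DIRECTION LETTERS, WITH THE SECOND-ORDER PAIR FAMILIES BY THE LEFT NEUMANN
# SERIES: dag-n06-c's `B9RWSumsAllBlocksPairMGDir.thm310Printed_allPin_completePairM_dir` with the third-order schema `FactorsL2Second310` REMOVED from `hop3`
# (dag-n06-w1 LOCATED-SCHEMA-1: off print's scale) in favour of the factor transposes `R♯_a = R_aᵀ` and one more «M large» threshold `2N_Fθ₀√L₀·c₁ ≤ M`

T. Bałaban, *Propagators for lattice gauge theories in a background field*, Commun. Math. Phys. **99** (1985) 389–434 [`Balaban1985BackgroundPropagators`, "B9"],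
Thm 3.10 (3.105)–(3.108) pp. 414–416, p. 413, (3.42)–(3.47) pp. 397–398; T. Bałaban, *Propagators and renormalization transformations for lattice gauge theories. II*,
Commun. Math. Phys. **96** (1984) 223–250 [`Balaban1984PropagatorsII`], (2.51)–(2.55) pp. 232–233, Lemma 2.1 (2.60)–(2.61) p. 234.

statement-level skeleton of published theorems with citation tags; proofs where landed; nothing here is a claim about the Yang–Mills mass gap

WHY THIS FILE (cell `pub-ymgap`, node N06 [B9]; dag-n06-d g12 CALL on LOCATED-SCHEMA-1, dag-n06-c g12 «GO — the ₃ twins are yours»; width seat `pub-ymgap-dag-n06-w1` (g5)).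
The ₂ text is COPIED VERBATIM except: (i) `hop3`'s conjunct `FactorsL2Second310 (𝔬 i) (𝔡 i) (R i) (H i) θ3 δ₁ U` ↦ `∀ a, IsTransposePair ((𝔬 i).Rt U a) ((𝔬 i).Rf U a)`
(p. 391; faithful letters have `R♯_a = R_aᵀ`); (ii) `θ3 ∕ hθ3` DROPPED, `hB35`'s constant `secondConst … ↦ 2·(N₃·B₃)`; (iii) the member threshold gains `Mbig′ = 2N_Fθ₀√L₀·c₁(α₁)`;
(iv) the two second-order pair families come from dag-n06-w1's `B9RWSums346SecondDiffLeftPairMG.blockBd_second_family5∕3_left_pairMG` (`Factors389` — already in `hop` —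
through the Schur test, then the left series `G∇*∇* = Σ(Σ_aR♯_a)ⁿ·(G₀∇*∇*)`).  Conclusion and every other hypothesis VERBATIM ₂.

HONEST SCOPE.  Hypothesis schemas of printed shape + kernel bookkeeping; nothing of [B9] asserted; NOT a node discharge; count-neutral; one finite 𝕋^{d+1} programme at
fixed ε — nothing continuum, nothing about the mass gap; the YM mass gap (Clay) is NOT proved by any of this — R4 closes the conditional finite-𝕋⁴ rung `BalabanLadder.UV` only.
-/

namespace Literature.MathematicalPhysics.QuantumFieldTheory.Balaban1983to89.B9RWSumsAllBlocksPairMGDir3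

open Finset B6RandomWalk B6RandomWalkHom B9Thm34Ext B9Thm37Whole B9Cor38Whole B9Thm310Whole B9RWSums343to347Whole
open B9RWSums346Schur B9RWSums343Holder B9RWSums346Lap B9RWSums344Input B9RWSums346Two B9Thm37GlueCor36
open B9SectCDiffDict B9SectDL2Decay B11SectG B9Thm37AllNorms B9Thm37AllNormsInstances B9Ineq347 B9Ineq347AllEntries
open B9CoRealizesRel B9RWSumsReadsRel B9RWSumsReadsNbr B9RWSums346SecondDiff B9RWSums346SecondDiffGp B9Thm37Sum B9Thm37Glue B9RWSums343HolderGp B9RWSums344InputGp B9RWSums346TwoGp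
open B9RWSums346MixedPair B9RWSums344InputFam B9RWSums344InputPair
open B9RWSumsAllBlocksPairM B9Thm37WholeDir B9Thm310WholeDir B9RWSums343HolderDir B9RWSums346SecondDiffDir B9RWSums346MixedPairGDir B9RWSums344InputPairGDir B9RWSums346SecondDiffGpLeft B9RWSums346SecondDiffLeft B9RWSums346SecondDiffLeftPairMG

noncomputable section

section AllPinsG

variable {I : Type} {c35 : ℝ} {geo : I → B9.Geometry} {bg : I → B9.Backgrounds}
variable [∀ i, Fintype (geo i).Site] [∀ i, DecidableEq (geo i).Site]

/-- Arithmetic of «for M sufficiently large»: M ≧ 2N_Fθ₀c₁ gives N_F·θ₀M⁻¹·c₁ ≦ ½ (twin of the siblings' private lemma). [folklore] -/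
private theorem small_of_threshold_pair {NF θ₀ c M : ℝ} (hM : 0 < M) (hbig : 2 * NF * θ₀ * c ≤ M) :
    NF * (θ₀ * M⁻¹) * c ≤ 1 / 2 := by
  have h1 : NF * (θ₀ * M⁻¹) * c = (NF * θ₀ * c) / M := by
    rw [div_eq_mul_inv]
    ring
  rw [h1, div_le_iff₀ hM]
  linarith

/-- ★★ **(v2 OVER THE DIRECTION LETTERS, R1′-A: `hop ∋ Identities310₂`, member faces `holder343_of_local310_dir ∕ blockBd_second_family3∕5_dir ∕ inputPair3445_family_dir ∕ blockBd_mixed_family_dir`; everything else VERBATIM `B9RWSumsAllBlocksPairM.thm310Printed_allPin_completePairM`.)** ★★ **THEOREM 3.10 AT THE ALL-BLOCKS PIN WITH NO DISPLAYED RESIDUAL, THE (3.43)–(3.46) CO-READINGS SITED ON THE NEIGHBOURHOOD** — p. 416: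
*"From (3.108) it follows that the expansion (3.107) is convergent in all norms in the inequalities (3.42)–(3.47). This implies Theorem 3.3."*
The `Nbr` form of `B9RWSumsAllBlocksRel.thm310Printed_allPin_completeRel` (whose class-sited `L2ReadsRel`∕`H1ReadsRel`∕`InputReadsRel` binders are not
dischargeable at the record's coordinate pins — `B9RWSumsReadsRelNegative.not_l2ReadsRel_evBK`): the leaf `B9.Thm310Printed c35 geo bg (fun i =>
W310OfOps (𝔬 i) (rd i) (ConvAll3107 (𝔬 i) (R i) (H i) C δ (K i) B₀ δ₀ Bβ Bε Bεβ))` from the leaf at the sup-block pin (`h310`) and, per member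
and per regular configuration, ONLY operator-level hypothesis schemas of printed shape about the local operators (`HolderLegs310`, `LapLegs310`,
`InputLegs310`, `L2TwoLegs310`), the elementary factors (`Factors389`, `FactorsHolder310`, `FactorsInput310`, `FactorsL2_310`), the structure
(3.105) (`Identities310`), the static data, the letters, the member facts — and the co-readings of `K i` (`CoRealizesRel` relative to `Rel i` (n06-l),
`GlobReads`, and the NEIGHBOURHOOD-SITED `L2ReadsNbr`, `H1ReadsNbr`, `InputReadsNbr` of radius r) with class multiplicity ≦ m, Lʲη, d saturated
on classes, neighbourhood count ≦ mN, level comparability CL and evaluation constant Cev; the multiplicities are folded into the constants'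
relations (m·C ≦ B₀, mN·m·Cev·CL²·e^{rδ₀}·C·L₀ ≦ B₀, mN·m·Cev·CL²·e^{rδ₀}·√(C·lapConst)·L₀ ≦ B₀, mN·m·Cev·CL²·e^{rδ₀}·twoConst ≦ B₀,
m·CL·e^{rδ₀}·holderConst(β) ≦ B(β), e^{rδ₀}·inputConst44 ≦ B′(ε), CL·e^{rδ₀}·inputConst45 ≦ B′(ε,β)).  Every
member line is PROVED inside through the operator lemmas `holder343_of_local310`, `inputPair3445_family`, `blockBd_mixed_family`,
`blockBd_second_family3∕5`, `blockBd_entry0∕1∕2`, `blockBd_pair_of_transpose` and §1.  Nothing of print asserted; every input is a hypothesis;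
NOT a node discharge. [cite: Balaban1985BackgroundPropagators, Thm 3.10 (3.105)–(3.108) pp.414–416 + Thm 3.3 p.399 + (3.42)–(3.47) pp.397–398 + Cor. 3.6 p.408 + p.413; Balaban1984PropagatorsII, (2.51)–(2.52) p.232 + Lemma 2.1 (2.60)–(2.61) p.234] -/
theorem thm310Printed_allPin_completePairM_dir₃ {X Y ι A PX PY Q : I → Type} [∀ i, Fintype (X i)] [∀ i, DecidableEq (X i)]
    [∀ i, Fintype (Y i)] [∀ i, DecidableEq (Y i)] [∀ i, Fintype (ι i)] [∀ i, Fintype (A i)] [∀ i, Fintype (PX i)]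
    [∀ i, DecidableEq (PX i)] [∀ i, Fintype (PY i)] [∀ i, DecidableEq (PY i)] [∀ i, Fintype (Q i)]
    {𝔬 : ∀ i, Ops310 (geo i) (bg i) (X i) (Y i) (ι i) (A i)}
    {rd : ∀ i, WalkReading310 (geo i) (bg i) (X i) (ι i) (A i)} {R : I → ℝ} {H : I → Prop} {C δ : ℝ}
    (𝔭 : ∀ i, HolderProbes (geo i) (bg i) (X i) (Y i) (PX i) (PY i)) (𝔡 : ∀ i, DirOps310 (𝔬 i) (Q i))
    (𝔩 : ∀ i, DirLetters310 (𝔬 i) (Q i))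
    (bHX : ∀ i, ℝ → BlockNorm (toB6 (geo i) (R i) (H i)) (X i → ℝ))
    (K : ∀ i, B9.KernelFamily (geo i) (bg i)) (ev : ∀ i, (geo i).Loc → X i → ℝ) (evY : ∀ i, (geo i).Loc → Y i → ℝ)
    (Rel : ∀ i, (geo i).Site → (geo i).Site → Prop) [∀ i, DecidableRel (Rel i)] (m : ℕ) (r Cev CL : ℝ) (mN : ℕ)
    {d : ℕ} {α L₀ B₀ δ₀ Mg : ℝ} {Bβ Bε : ℝ → ℝ} {Bεβ : ℝ → ℝ → ℝ}
    (κ : I → Sizes310) (SH : ∀ i, ι i → Finset (geo i).Site) (Bl θH : ℝ → ℝ) (d₁ : ℕ)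
    (δ₁ α₁ ρ N N' NF Cℓ θ₀ NH a₁ M₁ ML : ℝ)
    (S3 : ∀ i, ι i → Finset (geo i).Site) (N3 B3 NQ : ℝ)
    (SI : ∀ i, ι i → Finset (geo i).Site) (NI : ℝ) (BI θI : ℝ → ℝ) (BI2 : ℝ → ℝ → ℝ)
    (SM : ∀ i, ι i → Finset (geo i).Site) (NM BM θM : ℝ)
    (h310 : B9.Thm310Printed c35 geo bg (fun i => W310OfOps (𝔬 i) (rd i) (Conv3107 (𝔬 i) (R i) (H i) C δ)))
    (hRlen : ∀ i (a a' : (geo i).Site), Rel i a a' → (geo i).len a = (geo i).len a')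
    (hRd₁ : ∀ i (a a' b : (geo i).Site), Rel i a a' → (geo i).dist a b = (geo i).dist a' b)
    (hRd₂ : ∀ i (a b b' : (geo i).Site), Rel i b b' → (geo i).dist a b = (geo i).dist a b')
    (hmult : ∀ i (y' : (geo i).Site), (Finset.univ.filter (fun y'' => Rel i y'' y')).card ≤ m)
    (hnbr : ∀ i (y : (geo i).Site), (nbr (geo i) r y).card ≤ mN) (hCL1 : 1 ≤ CL)
    (hCLcmp : ∀ i (a a' : (geo i).Site), (geo i).dist a a' ≤ r → (geo i).len a ≤ CL * (geo i).len a')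
    (htri : ∀ i (a b c : (geo i).Site), (geo i).dist a c ≤ (geo i).dist a b + (geo i).dist b c) (hCev : 0 ≤ Cev)
    (hco0 : ∀ i U, CoRealizesRel (K i) 0 U (Rel i) (𝔬 i).blk (𝔬 i).blk (ev i) ((𝔬 i).G U))
    (hco1 : ∀ i U, CoRealizesRel (K i) 1 U (Rel i) (𝔬 i).blkY (𝔬 i).blk (ev i) ((𝔬 i).D U ∘ₗ (𝔬 i).G U))
    (hco2 : ∀ i U, CoRealizesRel (K i) 2 U (Rel i) (𝔬 i).blk (𝔬 i).blkY (evY i) ((𝔬 i).G U ∘ₗ (𝔬 i).Dstar U))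
    (hco3 : ∀ i U, CoRealizesRel (K i) 3 U (Rel i) (𝔬 i).blk (𝔬 i).blk (ev i) ((𝔬 i).Lap U ∘ₗ (𝔬 i).G U))
    (hgl0 : ∀ i U, GlobReads (K i) 0 U (𝔬 i).blk (𝔬 i).blk (ev i) ((𝔬 i).G U))
    (hgl1 : ∀ i U, GlobReads (K i) 1 U (𝔬 i).blkY (𝔬 i).blk (ev i) ((𝔬 i).D U ∘ₗ (𝔬 i).G U))
    (hgl2 : ∀ i U, GlobReads (K i) 2 U (𝔬 i).blk (𝔬 i).blkY (evY i) ((𝔬 i).G U ∘ₗ (𝔬 i).Dstar U))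
    (hgl3 : ∀ i U, GlobReads (K i) 3 U (𝔬 i).blk (𝔬 i).blk (ev i) ((𝔬 i).Lap U ∘ₗ (𝔬 i).G U))
    (hl0 : ∀ i U, L2ReadsNbr (R := R i) (H := H i) (K i) 0 U (Rel i) r Cev (𝔬 i).blk (𝔬 i).blk (ev i) ((𝔬 i).G U))
    (hl1 : ∀ i U, L2ReadsNbr (R := R i) (H := H i) (K i) 1 U (Rel i) r Cev (𝔬 i).blkY (𝔬 i).blk (ev i) ((𝔬 i).D U ∘ₗ (𝔬 i).G U))
    (hl2 : ∀ i U, L2ReadsNbr (R := R i) (H := H i) (K i) 2 U (Rel i) r Cev (𝔬 i).blk (𝔬 i).blkY (evY i)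
      ((𝔬 i).G U ∘ₗ (𝔬 i).Dstar U))
    (hl3 : ∀ i U, L2ReadsNbr (R := R i) (H := H i) (K i) 3 U (Rel i) r Cev ((𝔬 i).blk ∘ Prod.fst) (𝔬 i).blk (ev i)
      (familyOp fun p : Q i × Q i => (𝔡 i).Dd U p.1 ∘ₗ ((𝔬 i).G U ∘ₗ (𝔡 i).Dsd U p.2)))
    (hl4 : ∀ i U, L2ReadsNbr (R := R i) (H := H i) (K i) 4 U (Rel i) r Cev ((𝔬 i).blk ∘ Prod.fst) (𝔬 i).blk (ev i)
      (familyOp fun p : Q i × Q i => ((𝔡 i).Dd U p.1 ∘ₗ (𝔡 i).Dd U p.2) ∘ₗ (𝔬 i).G U))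
    (hl5 : ∀ i U, L2ReadsNbr (R := R i) (H := H i) (K i) 5 U (Rel i) r Cev ((𝔬 i).blk ∘ Prod.fst) (𝔬 i).blk (ev i)
      (familyOp fun p : Q i × Q i => (𝔬 i).G U ∘ₗ ((𝔡 i).Dsd U p.1 ∘ₗ (𝔡 i).Dsd U p.2)))
    (hH1 : ∀ i U, H1ReadsNbr (K i) U (𝔭 i) (Rel i) r (𝔬 i).blk (𝔬 i).blkY (ev i) (evY i) ((𝔬 i).D U ∘ₗ (𝔬 i).G U)
      ((𝔬 i).G U ∘ₗ (𝔬 i).Dstar U))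
    (hIR : ∀ i U, InputReadsFam (K i) U (bHX i) r ((𝔬 i).blk ∘ Prod.fst) ((𝔭 i).blkPX ∘ Prod.fst)
      (fun β => sliceProbe ((𝔭 i).ΦX U β)) (ev i)
      (familyOp fun p : Q i × Q i => (𝔡 i).Dd U p.1 ∘ₗ ((𝔬 i).G U ∘ₗ (𝔡 i).Dsd U p.2)))
    (hsym : ∀ i, M₁ ≤ (geo i).M → ∀ α₀ : ℝ, 0 < α₀ → c35 * (geo i).M * α₀ ≤ a₁ →
      ∀ U : (bg i).Cfg, (bg i).Reg335 c35 α₀ U → IsTransposePair ((𝔬 i).G U) ((𝔬 i).G U))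
    (htr : ∀ i, M₁ ≤ (geo i).M → ∀ α₀ : ℝ, 0 < α₀ → c35 * (geo i).M * α₀ ≤ a₁ →
      ∀ U : (bg i).Cfg, (bg i).Reg335 c35 α₀ U → IsTransposePair ((𝔬 i).D U ∘ₗ (𝔬 i).G U) ((𝔬 i).G U ∘ₗ (𝔬 i).Dstar U))
    (hfacts : ∀ i, Mg ≤ (geo i).M → Facts347 (geo i) (R i) (H i) d δ α L₀)
    (hdsymm : ∀ i (a b : (geo i).Site), (geo i).dist a b = (geo i).dist b a)
    (hC : 0 ≤ C) (hCB : (m : ℝ) * C ≤ B₀) (hCL : (mN : ℝ) * m * Cev * CL ^ 2 * Real.exp (r * δ₀) * (C * L₀) ≤ B₀)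
    (hδ₀nn : 0 ≤ δ₀) (hδ₀ : δ₀ ≤ (1 - α) * δ)
    (hδ₀2 : δ₀ ≤ (1 - 2 * α) * δ) (hα : 0 ≤ α * δ) (hα2 : 2 * α * δ ≤ δ) (hCg : C * B6.c1 d δ (1 - α) * L₀ ^ (4 : ℝ) ≤ B₀)
    (hc : 0 < c35) (ha₁ : 0 < a₁) (hα₁ : 0 ≤ α₁) (hα₁2 : α₁ ≤ 1 / 2) (hNF : 0 ≤ NF) (hθ₀ : 0 ≤ θ₀) (hNH : 0 ≤ NH)
    (hδnn : 0 ≤ δ) (hδ5 : δ ≤ (1 - 2 * α₁) * δ₁) (hδ₁ : 0 ≤ δ₁) (hN3 : 0 ≤ N3) (hB3 : 0 ≤ B3) (hNI : 0 ≤ NI)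
    (hNM : 0 ≤ NM) (hBM : 0 ≤ BM) (hθM : 0 ≤ θM)
    (hB35 : (mN : ℝ) * m * Cev * CL ^ 2 * Real.exp (r * δ₀) * (NQ * (2 * (N3 * B3))) ≤ B₀)
    (hB3M : (mN : ℝ) * m * Cev * CL ^ 2 * Real.exp (r * δ₀) * (NQ * mixedConst d₁ δ₁ α₁ NM BM NF θM C L₀) ≤ B₀)
    (hst : ∀ i, StaticOK310 (𝔬 i) ρ N N' NF Cℓ (κ i))
    (hcntH : ∀ i (a : (geo i).Site), (∑ q, if a ∈ SH i q then (1 : ℝ) else 0) ≤ NH)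
    (hcnt3 : ∀ i (a : (geo i).Site), (∑ q, if a ∈ S3 i q then (1 : ℝ) else 0) ≤ N3)
    (hNQ : ∀ i, (Fintype.card (Q i) : ℝ) ≤ NQ)
    (hcntI : ∀ i (a : (geo i).Site), (∑ q, if a ∈ SI i q then (1 : ℝ) else 0) ≤ NI)
    (hcntM : ∀ i (a : (geo i).Site), (∑ q, if a ∈ SM i q then (1 : ℝ) else 0) ≤ NM)
    (hBl : ∀ β, 0 ≤ β → β < 1 → 0 ≤ Bl β) (hθH : ∀ β, 0 ≤ β → β < 1 → 0 ≤ θH β)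
    (hBI : ∀ ε, 0 < ε → ε ≤ 1 → 0 ≤ BI ε) (hBI2 : ∀ ε β, 0 < ε → ε ≤ 1 → 0 ≤ β → β < 1 → 0 ≤ BI2 ε β)
    (hθI : ∀ ε, 0 < ε → 0 ≤ θI ε)
    (hBβ : ∀ β, 0 ≤ β → β < 1 → (m : ℝ) * CL * Real.exp (r * δ₀) * holderConst d₁ δ₁ α₁ NH NF C (Bl β) (θH β) ≤ Bβ β)
    (hBε : ∀ ε, 0 < ε → ε ≤ 1 → Real.exp (r * δ₀) * inputConst44 d₁ δ₁ α₁ NI NF C L₀ (BI ε) (θI ε) ≤ Bε ε)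
    (hBεβ : ∀ ε β, 0 < ε → ε ≤ 1 → 0 ≤ β → β < 1 →
      CL * Real.exp (r * δ₀) *
        inputConst45 d₁ δ₁ α₁ NI NF L₀ (holderConst d₁ δ₁ α₁ NH NF C (Bl β) (θH β)) (BI2 ε β) (θI (β + ε)) ≤ Bεβ ε β)
    (h261 : ∀ i, ML ≤ (geo i).M → Ineq261 d₁ (toB6 (geo i) (R i) (H i)) δ₁ α₁)
    (hop : ∀ i, M₁ ≤ (geo i).M → ∀ α₀ : ℝ, 0 < α₀ → c35 * (geo i).M * α₀ ≤ a₁ →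
      ∀ U : (bg i).Cfg, (bg i).Reg335 c35 α₀ U →
        Factors389 (𝔬 i) (R i) (H i) θ₀ δ₁ U ∧ Identities310₂ (𝔬 i) (𝔡 i) (𝔩 i) (R i) (H i) U ∧
          HolderLegs310 (𝔬 i) (𝔭 i) (R i) (H i) (SH i) Bl δ₁ U ∧ FactorsHolder310 (𝔬 i) (𝔭 i) (R i) (H i) θH δ₁ U)
    (hop3 : ∀ i, M₁ ≤ (geo i).M → ∀ α₀ : ℝ, 0 < α₀ → c35 * (geo i).M * α₀ ≤ a₁ →
      ∀ U : (bg i).Cfg, (bg i).Reg335 c35 α₀ U →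
        L2SecondLegs310 (𝔬 i) (𝔡 i) (R i) (H i) (S3 i) B3 δ₁ U ∧ (∀ a, IsTransposePair ((𝔬 i).Rt U a) ((𝔬 i).Rf U a)) ∧
          DirTranspose310 (𝔬 i) (𝔡 i) U)
    (hopI : ∀ i, M₁ ≤ (geo i).M → ∀ α₀ : ℝ, 0 < α₀ → c35 * (geo i).M * α₀ ≤ a₁ →
      ∀ U : (bg i).Cfg, (bg i).Reg335 c35 α₀ U →
        InputLegsPair310 (𝔬 i) (𝔡 i) (𝔭 i) (R i) (H i) (bHX i) (SI i) BI BI2 δ₁ U ∧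
          FactorsInputPair310 (𝔬 i) (𝔡 i) (R i) (H i) (bHX i) θI δ₁ U ∧ DirSupHolder310 (𝔬 i) (𝔡 i) (𝔭 i) (R i) (H i) U)
    (hopM : ∀ i, M₁ ≤ (geo i).M → ∀ α₀ : ℝ, 0 < α₀ → c35 * (geo i).M * α₀ ≤ a₁ →
      ∀ U : (bg i).Cfg, (bg i).Reg335 c35 α₀ U →
        L2MixedLegs310 (𝔬 i) (𝔡 i) (R i) (H i) (SM i) BM δ₁ U ∧ FactorsL2Mixed310 (𝔬 i) (𝔡 i) (R i) (H i) θM δ₁ U ∧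
          DirSup310 (𝔬 i) (𝔡 i) (R i) (H i) U) :
    B9.Thm310Printed c35 geo bg
      (fun i => W310OfOps (𝔬 i) (rd i) (ConvAll3107 (𝔬 i) (R i) (H i) C δ (K i) B₀ δ₀ Bβ Bε Bεβ)) := by
  have hαδ₁ : 0 ≤ α₁ * δ₁ := mul_nonneg hα₁ hδ₁
  have hrate : (1 - 2 * α) * δ ≤ (1 - α₁) * δ₁ := by nlinarith [hα, hδ5, hαδ₁]
  have hδδ₁ : δ ≤ (1 - α₁) * δ₁ := hδ5.trans (by nlinarith [hαδ₁])
  have hα₁1 : α₁ ≤ 1 := by linarith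
  have hαδ1 : α * δ ≤ δ := by linarith
  have hc1 : 0 ≤ B6.c1 d₁ δ₁ α₁ := c1_nonneg d₁ δ₁ α₁
  set Mbig : ℝ := 2 * NF * θ₀ * B6.c1 d₁ δ₁ α₁ with hMbig
  set Mbig' : ℝ := 2 * NF * θ₀ * Real.sqrt L₀ * B6.c1 d₁ δ₁ α₁ with hMbig'
  refine thm310Printed_W310OfOps_strengthen h310 (max (max (max Mg 1) (max (max M₁ ML) (max M₁ Mbig))) Mbig') (a₁ / c35)
    (div_pos ha₁ hc) fun i hM' α₀ hα₀ hMa U hU hconv => ?_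
  have hM : max (max Mg 1) (max (max M₁ ML) (max M₁ Mbig)) ≤ (geo i).M := le_trans (le_max_left _ _) hM'
  have hMb' : Mbig' ≤ (geo i).M := le_trans (le_max_right _ _) hM'
  have hMg : Mg ≤ (geo i).M := le_trans (le_trans (le_max_left _ _) (le_max_left _ _)) hM
  have hM1 : 1 ≤ (geo i).M := le_trans (le_trans (le_max_right _ _) (le_max_left _ _)) hM
  have hM₁i : M₁ ≤ (geo i).M := le_trans (le_trans (le_trans (le_max_left _ _) (le_max_left _ _)) (le_max_right _ _)) hM
  have hMLi : ML ≤ (geo i).M := le_trans (le_trans (le_trans (le_max_right _ _) (le_max_left _ _)) (le_max_right _ _)) hM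
  have hMb : Mbig ≤ (geo i).M := le_trans (le_trans (le_trans (le_max_right _ _) (le_max_right _ _)) (le_max_right _ _)) hM
  have hMpos : 0 < (geo i).M := lt_of_lt_of_le one_pos hM1
  have ha : c35 * (geo i).M * α₀ ≤ a₁ := by
    have h1 : (geo i).M * α₀ * c35 ≤ a₁ := (le_div_iff₀ hc).mp hMa
    calc c35 * (geo i).M * α₀ = (geo i).M * α₀ * c35 := by ring
      _ ≤ a₁ := h1
  obtain ⟨h0, h1, h2, h3⟩ := hconv
  obtain ⟨hf, hi, hL, hFH⟩ := hop i hM₁i α₀ hα₀ ha U hU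
  obtain ⟨hL3, hRT, hDT⟩ := hop3 i hM₁i α₀ hα₀ ha U hU
  obtain ⟨hIL, hFI, hDH⟩ := hopI i hM₁i α₀ hα₀ ha U hU
  obtain ⟨hLM, hFLM, hDS⟩ := hopM i hM₁i α₀ hα₀ ha U hU
  have hq : NF * (θ₀ * ((geo i).M)⁻¹) * B6.c1 d₁ δ₁ α₁ ≤ 1 / 2 :=
    small_of_threshold_pair hMpos (by rw [hMbig] at hMb; exact hMb)
  have hF := hfacts i hMg
  have hL₀ : 0 ≤ L₀ := le_trans (le_trans zero_le_one hF.one_le_L) hF.L_le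
  have hlen : ∀ y : (geo i).Site, 0 < (geo i).len y := (hst i).lenpos
  -- the operator-level majorants of the members (3.43), (3.46) K-indices 4∕5 (pair families), (3.44)∕(3.45), (3.46) K-index 3 (mixed)
  have hH := holder343_of_local310_dir (𝔬 i) (𝔡 i) (𝔩 i) (𝔭 i) (R i) (H i) d₁ δ₁ α₁ ρ N N' NF Cℓ θ₀ NH C δ (κ i) (SH i) Bl θH U hδ₁ hα₁
    hα₁1 hNF hθ₀ hNH hM1 hC hδnn hδδ₁ (hst i) (hcntH i) hBl hθH (h261 i hMLi) hq hf hi hL hFH h2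
  have hH' : ∀ β : ℝ, 0 ≤ β → β < 1 →
      HasMajorantHom (g := toB6 (geo i) (R i) (H i)) (𝔬 i).blk (𝔭 i).blkPY ((𝔭 i).ΦY U β ∘ₗ ((𝔬 i).D U ∘ₗ (𝔬 i).G U))
          (fun (a b : (geo i).Site) => holderConst d₁ δ₁ α₁ NH NF C (Bl β) (θH β) * (geo i).len a ^ (1 - β) *
            Real.exp (-(δ * (geo i).dist a b))) ∧
        HasMajorantHom (g := toB6 (geo i) (R i) (H i)) (𝔬 i).blkY (𝔭 i).blkPX ((𝔭 i).ΦX U β ∘ₗ ((𝔬 i).G U ∘ₗ (𝔬 i).Dstar U))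
          (fun (a b : (geo i).Site) => holderConst d₁ δ₁ α₁ NH NF C (Bl β) (θH β) * (geo i).len a ^ (1 - β) *
            Real.exp (-(δ * (geo i).dist a b))) := by
    intro β hβ0 hβ1
    have h := hH β hβ0 hβ1
    rw [LinearMap.comp_assoc] at h
    exact h
  have hK2 : 0 ≤ 2 * (N3 * B3) := by positivity
  have hwk : ∀ a b : (geo i).Site, (Fintype.card (Q i) : ℝ) * (2 * (N3 * B3)) *
      Real.exp (-((1 - 2 * α) * δ * (geo i).dist a b)) ≤ NQ * (2 * (N3 * B3)) *
      Real.exp (-((1 - 2 * α) * δ * (geo i).dist a b)) := fun a b =>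
    mul_le_mul_of_nonneg_right (mul_le_mul_of_nonneg_right (hNQ i) hK2) (Real.exp_nonneg _)
  -- the second-order pair families by the LEFT Neumann series (dag-n06-w1 `B9RWSums346SecondDiffLeftPairMG`): no third-order factor schema
  have hb4f := (blockBd_second_family3_left_pairMG (𝔬 i) (𝔡 i) (𝔩 i) (R i) (H i) d d₁ δ α L₀ δ₁ α₁ ρ N N' NF Cℓ N3 B3 θ₀ (κ i) (S3 i) U hNF hN3 hB3
    hθ₀ hδ₁ hα₁ hα hα2 hδ5 (hst i) hM1 (by rw [hMbig'] at hMb'; exact hMb') (hcnt3 i) (h261 i hMLi) hF hi hf hRT hL3 hDT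
    (hsym i hM₁i α₀ hα₀ ha U hU)).mono hwk
  have hb5 := (blockBd_second_family5_left_pairMG (𝔬 i) (𝔡 i) (𝔩 i) (R i) (H i) d d₁ δ α L₀ δ₁ α₁ ρ N N' NF Cℓ N3 B3 θ₀ (κ i) (S3 i) U hNF hN3 hB3
    hθ₀ hδ₁ hα₁ hα hα2 hδ5 (hst i) hM1 (by rw [hMbig'] at hMb'; exact hMb') (hcnt3 i) (h261 i hMLi) hF hi hf hRT hL3).mono hwk
  -- the nonnegativity of the Hölder constant; the mixed family's L² bound and its (3.44)∕(3.45) majorants (sliced probes)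
  have hK0 : ∀ β, 0 ≤ β → β < 1 → 0 ≤ holderConst d₁ δ₁ α₁ NH NF C (Bl β) (θH β) := by
    intro β hβ0 hβ1
    have hb := hBl β hβ0 hβ1
    have ht := hθH β hβ0 hβ1
    unfold holderConst
    positivity
  obtain ⟨h44, h45⟩ := inputPair3445_family_dir (𝔬 i) (𝔡 i) (𝔩 i) (𝔭 i) (R i) (H i) (bHX i) d d₁ δ α L₀ δ₁ α₁ ρ N N' NF Cℓ NI C (κ i)
    (SI i) (fun β => holderConst d₁ δ₁ α₁ NH NF C (Bl β) (θH β)) BI θI BI2 U hδ₁ hα₁ hNF hNI hM1 hC hδδ₁ hα hαδ1 (hst i)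
    (hcntI i) hK0 hBI hBI2 hθI (h261 i hMLi) hF hi hIL hFI hDS hDH h1 (fun β hβ0 hβ1 => (hH β hβ0 hβ1).1)
  have hKM : 0 ≤ mixedConst d₁ δ₁ α₁ NM BM NF θM C L₀ := mixedConst_nonneg hNM hBM hNF hθM hC hL₀
  have hwkM : ∀ a b : (geo i).Site, (Fintype.card (Q i) : ℝ) * mixedConst d₁ δ₁ α₁ NM BM NF θM C L₀ *
      Real.exp (-((1 - 2 * α) * δ * (geo i).dist a b)) ≤ NQ * mixedConst d₁ δ₁ α₁ NM BM NF θM C L₀ *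
      Real.exp (-((1 - 2 * α) * δ * (geo i).dist a b)) := fun a b =>
    mul_le_mul_of_nonneg_right (mul_le_mul_of_nonneg_right (hNQ i) hKM) (Real.exp_nonneg _)
  have hb3f := (blockBd_mixed_family_dir (𝔬 i) (𝔡 i) (𝔩 i) (R i) (H i) d d₁ δ α L₀ δ₁ α₁ ρ N N' NF Cℓ NM BM θM C (κ i) (SM i) U hNF hNM
    hBM hθM hM1 hC hα2 hαδ₁ hrate (hst i) (hcntM i) (h261 i hMLi) hF hi hLM hFLM hDS hDT h1 h2 (hsym i hM₁i α₀ hα₀ ha U hU)).mono hwkM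
  -- the nonnegativity of the operator-level constants
  have hK35 : 0 ≤ NQ * (2 * (N3 * B3)) :=
    mul_nonneg ((Nat.cast_nonneg _).trans (hNQ i)) hK2
  have hK3M : 0 ≤ NQ * mixedConst d₁ δ₁ α₁ NM BM NF θM C L₀ :=
    mul_nonneg ((Nat.cast_nonneg _).trans (hNQ i)) hKM
  have hK44 : ∀ ε, 0 < ε → ε ≤ 1 → 0 ≤ inputConst44 d₁ δ₁ α₁ NI NF C L₀ (BI ε) (θI ε) := by
    intro ε hε0 hε1
    have hb := hBI ε hε0 hε1
    have ht := hθI ε hε0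
    unfold inputConst44
    positivity
  have hK45 : ∀ ε β, 0 < ε → ε ≤ 1 → 0 ≤ β → β < 1 →
      0 ≤ inputConst45 d₁ δ₁ α₁ NI NF L₀ (holderConst d₁ δ₁ α₁ NH NF C (Bl β) (θH β)) (BI2 ε β) (θI (β + ε)) := by
    intro ε β hε0 hε1 hβ0 hβ1
    have hb := hBI2 ε β hε0 hε1 hβ0 hβ1
    have ht := hθI (β + ε) (by linarith)
    have hh := hK0 β hβ0 hβ1
    unfold inputConst45
    positivity
  exact ⟨⟨h0, h1, h2, h3⟩, allIneqs_of_majorants_pairM (R := R i) (H := H i) (𝔭 i) (bHX i) (𝔬 i).blk (𝔬 i).blkY (ev i) (evY i)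
    (Rel i) m r Cev CL mN (hRlen i) (hRd₁ i) (hRd₂ i) (hmult i) (hnbr i) hCL1 (hCLcmp i) (htri i) hCev h0 h1 h2 h3 hH'
    hb3f hb4f hb5 h44 h45 (hsym i hM₁i α₀ hα₀ ha U hU) (htr i hM₁i α₀ hα₀ ha U hU)
    (hco0 i U) (hco1 i U) (hco2 i U) (hco3 i U) (hgl0 i U) (hgl1 i U) (hgl2 i U) (hgl3 i U) (hl0 i U) (hl1 i U) (hl2 i U)
    (hl3 i U) (hl4 i U) (hl5 i U) (hH1 i U) (hIR i U) hF (hdsymm i) (hst i).dnn hlen hC hK35 hK3M hK0 hK44 hK45 hα hδ₀nn hδ₀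
    hδ₀2 hCB hCg hCL hB35 hB3M hBβ hBε hBεβ⟩

end AllPinsG

end

end Literature.MathematicalPhysics.QuantumFieldTheory.Balaban1983to89.B9RWSumsAllBlocksPairMGDir3
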